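import Summits.BirchSwinnertonDyer.Rank1Residual.GaloisImage.MultiplicativeValuationLargeImage
import Summits.BirchSwinnertonDyer.Rank1Residual.X11b.MultiplicativeSurjectivityTwist
import Summits.BirchSwinnertonDyer.Rank1Residual.X11b.VisibilityPrimeList
import HarnessLib

/-!
# BSD rank-≤1 residual cell: `E(ℚ_p)[p] = 0` at a multiplicative odd `p` with `p ∤ ord_p(Δ_min)` —
# the local-torsion binder of the visibility certificates at `v = p` is a one-integer check

HONEST FRAMING (cell `b2b-bsdres-*`, run/shared/lean/b2b/bsd-rank1-residual/, verbatim): the goal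
of the cell is to DELETE the COMBINATION-SHAPED residual classes for ALL analytic-rank `≤ 1` elliptic
curves over `ℚ` — "full BSD formula for every rank `≤ 1` curve in class C" assembled STRICTLY from
published theorems — so that the rank-`≤ 1` remainder becomes exactly the CONSTRUCTION-SHAPED
classes, which are TYPED (missing-input Props), NOT attempted; this is not "finishing BSD".
Unit `b2b-bsdres-x11c` (gen 8). Theorems only (no definition, no named fact); a TOOL file; no
class theorem, no label moves, nothing booked.

## What this file proves

* `natCard_ker_nsmul_adicCompletion_eq_one_of_mult_of_not_dvd` — for a globally minimal `E/ℚ`, an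
  odd prime `p` of MULTIPLICATIVE reduction with `p ∤ ord_p(Δ_min)`, and `v` the place of `𝓞 ℚ`
  above `p`: **`E(ℚ_v)` has no point of order `p`**, in the exact shape of the local binder
  `hloc : ∀ v ∈ S, Nat.card (nsmulAddMonoidHom p : E'(ℚ_v) →+ E'(ℚ_v)).ker = 1` of the rank-one
  VISIBILITY theorem `X11b.bsdp_of_kolyvagin_of_congr` (gen 4) and its 31 per-pair instances
  (gens 4, 6: `Visibility/RankOnePairs{1..8}.lean`, `X11b/VisibilityPair403280bd1.lean`), where it
  was a numerically certified HYPOTHESIS at every `v ∈ S`.  At `v = p` it is now a theorem whenever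
  the partner curve `E'` has `p ∥ N_{E'}` and `p ∤ ord_p Δ_min(E')` — the case for ALL 11 of the 30
  gen-6 pairs whose partner is multiplicative at `3` (`ord_3 Δ_{E'} ∈ {2, 4, 7}`; data
  `b2b-bsdres-x11c/gen6/pairs.json`).
* `natCard_ker_nsmul_adicCompletion_eq_one_of_mult_of_not_dvd_padicValRat_j` — the same for ANY
  model `W/ℚ` (not necessarily minimal), hypothesis `¬ p ∣ ord_p j(E)` (at a multiplicative prime
  `ord_p j = -ord_p Δ_min`; transport along a change of variables to a global minimal model,
  `VariableChange.pointEquivBaseChange`).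
* `X11b.bsdp_of_kolyvagin_of_congr_of_primeList_of_mult` — the gen-6 prime-list form of the
  visibility theorem with the local binder at `v = p` DISCHARGED when the partner `E'` is
  multiplicative at `p` with `p ∤ ord_p j(E')` (the remaining `hloc` asks only for the primes
  `q ∈ L`, `q ≠ p`).
* Mechanism: a `ℚ_v`-rational `p`-torsion point is a point of `E[p] ⊂ E(ℚ̄)` (all torsion is
  algebraic, `exists_pointsMapOfEmb_eq_of_nsmul_eq_zero`) fixed by all of `Γ_{ℚ_v}`, in particular
  by the inertia group `I_𝔐`; but `E[p]^{I_p} = 0` when `p ∤ ord_p Δ_min`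
  (`eq_zero_of_forall_inertia_smul_eq_of_hasMultiplicativeReductionAt_of_not_dvd`,
  `MultiplicativeInertiaFixedPoints.lean`: Serre 1972 §1.12, valuation half of the Kummer criterion
  — on the Tate curve, `E_q[p](ℚ_p^nr) = 0` when `p ∤ v(q)`).

NOT claimed: anything at `v ≠ p` (there `E(ℚ_v)[p]` is governed by `a_v`, `c_v`, not by inertia at
`p`), anything when `p ∣ ord_p Δ_min` (e.g. split multiplicative `p ∣ c_p`: `E(ℚ_p)[p]` may be
non-zero), `p = 2`.

## References

* [SerreInventiones1972] J.-P. Serre, Invent. Math. 15 (1972), §1.12 (Cor. of Prop. 13).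
* [SilvermanATAEC1994] J. H. Silverman, *Advanced Topics*, V.4, Cor. IV.9.2(d), V.6 Prop. 6.1.
* [SilvermanAEC2009] J. H. Silverman, *AEC* 2nd ed., Cor. III.6.4(b), VII.3.1.
-/

noncomputable section

open scoped Classical NumberField NNReal
open IsDedekindDomain Field NumberField
open WeierstrassCurve Literature.NumberTheory.EllipticCurves Literature.NumberTheory.GaloisRepresentations
  Rat.HeightOneSpectrum Literature.NumberTheory.EllipticCurves.Rank1Residual

namespace Summit.BirchSwinnertonDyer.Rank1Residual.GaloisImage

variable (W : WeierstrassCurve ℚ) [W.IsElliptic] (p : ℕ) [hp : Fact p.Prime]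

/-- **No `p`-torsion in `E(ℚ_v^nr)`-fixed form: a point of `E[p] ⊂ E(ℚ̄)` whose image in `E(ℚ̄_v)`
is fixed by the inertia group `I_𝔐 ≤ Γ_{ℚ_v}` is `O`**, for `v` the place above an odd
multiplicative `p` with `p ∤ ord_p(Δ_min)` (globally minimal `E/ℚ`; the integer form of the
hypothesis of `eq_zero_of_forall_inertia_smul_eq_of_hasMultiplicativeReductionAt_of_not_dvd`).
[cite: SerreInventiones1972, §1.12 (Cor. of Prop. 13)] -/
theorem eq_zero_of_forall_inertia_smul_eq_of_mult_of_not_dvd [W.IsGloballyMinimal] (hp2 : p ≠ 2)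
    (hmult : Mult W p) (hn : ¬ p ∣ padicValInt p W.minimalDiscriminantInt)
    {v : HeightOneSpectrum (𝓞 ℚ)} (hv : (primesEquiv v : ℕ) = p)
    {w : Valuation (AlgebraicClosure (v.adicCompletion ℚ)) ℝ≥0}
    (hw : ∀ x, (w x : ℝ) =
      spectralNorm (v.adicCompletion ℚ) (AlgebraicClosure (v.adicCompletion ℚ)) x)
    {𝔐 : Ideal v.localAbsIntegers} (h𝔐 : 𝔐 ∈ v.localPrimesAbove)
    {P : geomTorsion W (p : ℤ)}
    (hfix : ∀ τ ∈ 𝔐.inertia (absoluteGaloisGroup (v.adicCompletion ℚ)),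
      absGaloisRestrict ℚ (v.adicCompletion ℚ) τ • P = P) : P = 0 := by
  have hpp : p.Prime := hp.out
  have hpv : (p : 𝓞 ℚ) ∈ v.asIdeal := by
    have hgen : natGenerator v = p := hv
    have h := (natGenerator_dvd_iff v).mp dvd_rfl
    rw [← map_natCast (Rat.IsIntegralClosure.intEquiv (𝓞 ℚ)), Ideal.apply_mem_of_equiv_iff] at h
    rwa [hgen] at h
  have hmult' : haveI := Fact.mk (primesEquiv v).2
      W.HasMultiplicativeReductionAtPrime (primesEquiv v) := by
    have key : ∀ (q : ℕ) (hq : Fact q.Prime), q = p →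
        @WeierstrassCurve.HasMultiplicativeReductionAtPrime W q hq := by
      rintro q hq rfl; exact hmult
    exact key _ _ hv
  have hmultv : W.HasMultiplicativeReductionAt v :=
    (W.hasMultiplicativeReductionAtPrime_iff_hasMultiplicativeReductionAt_ringOfIntegers v).mp hmult'
  have hnd : ¬ p ∣ W.ordMinimalDiscriminant v := by
    rwa [X11b.ordMinimalDiscriminant_eq_padicValInt W v hv]
  exact eq_zero_of_forall_inertia_smul_eq_of_hasMultiplicativeReductionAt_of_not_dvd W p hp2 v hpv
    hmultv hnd (natCast_dvd_of_mem_maximalIdeal_of_primesEquiv_eq p hv) hw h𝔐 hfix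

/-- **`E(ℚ_v)[p] = 0` (kernel form `ker [p] = ⊥`) at the place `v` above an odd multiplicative `p`
with `p ∤ ord_p(Δ_min)`, globally minimal `E/ℚ`.**  A `ℚ_v`-rational point `P` with `pP = O` maps
(injectively) to a `p`-torsion point of `E(ℚ̄_v)`, which is the image of a point `Q ∈ E[p]`
(`exists_pointsMapOfEmb_eq_of_nsmul_eq_zero`); `Γ_{ℚ_v}` fixes the image, so (equivariance and
injectivity of `E(ℚ̄) → E(ℚ̄_v)`) the inertia group fixes `Q`, whence `Q = O` by
`eq_zero_of_forall_inertia_smul_eq_of_mult_of_not_dvd`. [cite: SerreInventiones1972, §1.12 (Cor. of Prop. 13)]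
[cite: SilvermanAEC2009, Cor. III.6.4(b)] -/
theorem ker_nsmul_adicCompletion_eq_bot_of_mult_of_not_dvd [W.IsGloballyMinimal]
    (hp2 : p ≠ 2) (hmult : Mult W p) (hn : ¬ p ∣ padicValInt p W.minimalDiscriminantInt)
    {v : HeightOneSpectrum (𝓞 ℚ)} (hv : (primesEquiv v : ℕ) = p) :
    (nsmulAddMonoidHom p : (W.baseChange (v.adicCompletion ℚ)).toAffine.Point →+
      (W.baseChange (v.adicCompletion ℚ)).toAffine.Point).ker = ⊥ := by
  have hpp : p.Prime := hp.out
  have hp0 : p ≠ 0 := hpp.ne_zero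
  set Kv := v.adicCompletion ℚ with hKv
  obtain ⟨w, hw⟩ := v.exists_spectralValuation
  obtain ⟨𝔐, h𝔐⟩ := v.localPrimesAbove_nonempty
  -- the `ℚ`-algebra map `ℚ_v → ℚ̄_v` and the induced injection on points
  let f : Kv →ₐ[ℚ] AlgebraicClosure Kv :=
    { algebraMap Kv (AlgebraicClosure Kv) with
      commutes' := fun r ↦ by
        simp only [RingHom.toMonoidHom_eq_coe, OneHom.toFun_eq_coe, MonoidHom.toOneHom_coe,
          MonoidHom.coe_coe]
        rw [IsScalarTower.algebraMap_apply ℚ Kv (AlgebraicClosure Kv)] }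
  rw [AddSubgroup.eq_bot_iff_forall]
  intro P hP
  rw [AddMonoidHom.mem_ker, nsmulAddMonoidHom_apply] at hP
  -- the image `PL ∈ E(ℚ̄_v)`, fixed by `Γ_{ℚ_v}`
  set PL : localPoints W Kv := Affine.Point.map f P with hPL
  have hPLp' : p • Affine.Point.map f P = 0 := by rw [← map_nsmul, hP, map_zero]
  have hPLp : p • PL = 0 := hPLp'
  have hcomp : ∀ σ : absoluteGaloisGroup Kv,
      ((AlgEquiv.restrictScalars ℚ
          (show AlgebraicClosure Kv ≃ₐ[Kv] AlgebraicClosure Kv from σ) :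
            AlgebraicClosure Kv ≃ₐ[ℚ] AlgebraicClosure Kv) :
          AlgebraicClosure Kv →ₐ[ℚ] AlgebraicClosure Kv).comp f = f := by
    intro σ
    apply AlgHom.ext
    intro z
    change (show AlgebraicClosure Kv ≃ₐ[Kv] AlgebraicClosure Kv from σ)
      (algebraMap Kv (AlgebraicClosure Kv) z) = algebraMap Kv (AlgebraicClosure Kv) z
    exact AlgEquiv.commutes _ z
  have hPLfix : ∀ σ : absoluteGaloisGroup Kv, σ • PL = PL := by
    intro σ
    rw [localPoints.smul_def, hPL]
    change Affine.Point.map ((AlgEquiv.restrictScalars ℚ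
          (show AlgebraicClosure Kv ≃ₐ[Kv] AlgebraicClosure Kv from σ) :
            AlgebraicClosure Kv ≃ₐ[ℚ] AlgebraicClosure Kv) :
          AlgebraicClosure Kv →ₐ[ℚ] AlgebraicClosure Kv) (Affine.Point.map f P) =
        Affine.Point.map f P
    rw [Affine.Point.map_map, hcomp σ]
  -- `PL` comes from `E[p] ⊂ E(ℚ̄)`
  obtain ⟨Q, hQp, hQ⟩ :=
    exists_pointsMapOfEmb_eq_of_nsmul_eq_zero W (closureEmb (K := ℚ) Kv) hp0 hPLp
  have hQmem : Q ∈ geomTorsion W (p : ℤ) :=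
    (Submodule.mem_torsionBy_iff _ _).mpr (by rw [natCast_zsmul]; exact hQp)
  set Qt : geomTorsion W (p : ℤ) := ⟨Q, hQmem⟩ with hQt
  have hQtfix : ∀ τ ∈ 𝔐.inertia (absoluteGaloisGroup Kv),
      absGaloisRestrict ℚ Kv τ • Qt = Qt := by
    intro τ _
    apply Subtype.ext
    rw [Literature.NumberTheory.EllipticCurves.AddSubgroup.torsionBy.coe_smul]
    change absGaloisRestrict ℚ Kv τ • Q = Q
    apply pointsMapOfEmb_injective W (closureEmb (K := ℚ) Kv)
    have h1 := pointsMap_smul W Kv τ Q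
    rw [resGal_eq_absGaloisRestrict] at h1
    change pointsMapOfEmb W (closureEmb (K := ℚ) Kv) (absGaloisRestrict ℚ Kv τ • Q) =
      τ • pointsMapOfEmb W (closureEmb (K := ℚ) Kv) Q at h1
    rw [h1, hQ, hPLfix]
  have hQ0 : Qt = 0 :=
    eq_zero_of_forall_inertia_smul_eq_of_mult_of_not_dvd W p hp2 hmult hn hv hw h𝔐 hQtfix
  have hQ0' : Q = 0 := congrArg Subtype.val hQ0
  have hPL0 : PL = 0 := by rw [← hQ, hQ0', map_zero]
  apply Affine.Point.map_injective (f := f)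
  rw [map_zero, ← hPL, hPL0]
  rfl

/-- **`E(ℚ_v)[p] = 0` at the place `v` above an odd multiplicative `p` with `p ∤ ord_p(Δ_min)`**
(globally minimal `E/ℚ`), in the shape of the local binder of `X11b.bsdp_of_kolyvagin_of_congr`:
`Nat.card (ker (P ↦ p • P : E(ℚ_v) → E(ℚ_v))) = 1`.
[cite: SerreInventiones1972, §1.12 (Cor. of Prop. 13)] [cite: SilvermanAEC2009, Cor. III.6.4(b)] -/
theorem natCard_ker_nsmul_adicCompletion_eq_one_of_mult_of_not_dvd [W.IsGloballyMinimal]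
    (hp2 : p ≠ 2) (hmult : Mult W p) (hn : ¬ p ∣ padicValInt p W.minimalDiscriminantInt)
    {v : HeightOneSpectrum (𝓞 ℚ)} (hv : (primesEquiv v : ℕ) = p) :
    Nat.card (nsmulAddMonoidHom p : (W.baseChange (v.adicCompletion ℚ)).toAffine.Point →+
      (W.baseChange (v.adicCompletion ℚ)).toAffine.Point).ker = 1 := by
  rw [ker_nsmul_adicCompletion_eq_bot_of_mult_of_not_dvd W p hp2 hmult hn hv, AddSubgroup.card_bot]

/-- **`E(ℚ_v)[p] = 0`, MODEL-FREE form**: for ANY Weierstrass model `W/ℚ` of the curve (not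
necessarily minimal), an odd multiplicative `p` with `p ∤ ord_p j(E)` (at a multiplicative prime
`ord_p j = -ord_p Δ_min`, `AdditivePotMult.dvd_padicValInt_minimalDiscriminantInt_iff_of_mult`) and
`v` the place above `p`: `Nat.card (ker [p] : E(ℚ_v)) = 1`.  Transport to a global minimal model
`C • W` (`hasGlobalMinimalModel_rat_holds`) along the substitution isomorphism
`W(ℚ_v) ≃+ (C • W)(ℚ_v)` (`VariableChange.pointEquivBaseChange`).
[cite: SerreInventiones1972, §1.12 (Cor. of Prop. 13)] [cite: SilvermanAEC2009, III.3.1(b) and VII.1.3] -/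
theorem natCard_ker_nsmul_adicCompletion_eq_one_of_mult_of_not_dvd_padicValRat_j
    (hp2 : p ≠ 2) (hmult : Mult W p) (hj : ¬ (p : ℤ) ∣ padicValRat p W.j)
    {v : HeightOneSpectrum (𝓞 ℚ)} (hv : (primesEquiv v : ℕ) = p) :
    Nat.card (nsmulAddMonoidHom p : (W.baseChange (v.adicCompletion ℚ)).toAffine.Point →+
      (W.baseChange (v.adicCompletion ℚ)).toAffine.Point).ker = 1 := by
  obtain ⟨C, hC⟩ := hasGlobalMinimalModel_rat_holds W
  haveI : (C • W).IsGloballyMinimal := hC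
  have hmult' : Mult (C • W) p := (hasMultiplicativeReductionAtPrime_smul_iff W C p).mpr hmult
  have hΔ : ¬ p ∣ padicValInt p (C • W).minimalDiscriminantInt := by
    rw [AdditivePotMult.dvd_padicValInt_minimalDiscriminantInt_iff_of_mult (C • W) p hmult' p,
      variableChange_j]
    exact hj
  have hbot := ker_nsmul_adicCompletion_eq_bot_of_mult_of_not_dvd (C • W) p hp2 hmult' hΔ hv
  set e := VariableChange.pointEquivBaseChange W C (v.adicCompletion ℚ) with he
  have hbotW : (nsmulAddMonoidHom p : (W.baseChange (v.adicCompletion ℚ)).toAffine.Point →+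
      (W.baseChange (v.adicCompletion ℚ)).toAffine.Point).ker = ⊥ := by
    rw [AddSubgroup.eq_bot_iff_forall]
    intro P hP
    rw [AddMonoidHom.mem_ker, nsmulAddMonoidHom_apply] at hP
    have heP : e P ∈ (nsmulAddMonoidHom p :
        ((C • W).baseChange (v.adicCompletion ℚ)).toAffine.Point →+
          ((C • W).baseChange (v.adicCompletion ℚ)).toAffine.Point).ker := by
      rw [AddMonoidHom.mem_ker, nsmulAddMonoidHom_apply, ← map_nsmul, hP, map_zero]
    rw [hbot, AddSubgroup.mem_bot] at heP
    exact e.injective (by rw [heP, map_zero])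
  rw [hbotW, AddSubgroup.card_bot]

end Summit.BirchSwinnertonDyer.Rank1Residual.GaloisImage

/-! ### The visibility certificate with the local binder at `v = p` discharged -/

namespace Summit.BirchSwinnertonDyer.Rank1Residual.X11b

open GaloisImage

/-- **Rank-one visibility, prime-list form, with `E'(ℚ_p)[p] = 0` PROVED**: the gen-6 theorem
`bsdp_of_kolyvagin_of_congr_of_primeList` where the local binder `hloc` is asked only at the primes
`q ∈ L` with `q ≠ p`; at `q = p` it is supplied by
`natCard_ker_nsmul_adicCompletion_eq_one_of_mult_of_not_dvd_padicValRat_j` from the two DECIDABLE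
hypotheses on the partner: `Mult W' p` and `¬ p ∣ ord_p j(E')` (any model of `E'`).  Applies to
the 11 of the 30 gen-6 survivor classes whose rank-3 partner is multiplicative at `3`
(`ord_3 Δ_{E'} ∈ {2, 4, 7}`) and leaves the other members of `S` as certified binders.  Per pair;
not a class theorem; nothing booked. [cite: McCallumLMS1991, §1 Theorem (Kolyvagin), p. 296]
[cite: CremonaMazur2000, §3 and Table 1] [cite: SerreInventiones1972, §1.12 (Cor. of Prop. 13)] -/
theorem bsdp_of_kolyvagin_of_congr_of_primeList_of_mult (W : WeierstrassCurve ℚ) [W.IsElliptic]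
    (p : ℕ) [Fact p.Prime] (hCT : exists_casselsTate_pairing (K := ℚ))
    (hGZK : rank_eq_analyticRank_of_analyticRank_le_one)
    {N : ℕ} [NeZero N] {K : Type} [Field K] [NumberField K] (hKo : kolyvagin N W K)
    (hB : Kolyvagin1990_padicValNat_card_sha_le N W K) (hK : IsImaginaryQuadratic K)
    (hH : SatisfiesHeegnerHypothesis N K) {P : (W.baseChange K).toAffine.Point}
    (hP : IsHeegnerPoint N W K P) (hnt : ¬ IsOfFinAddOrder P)
    (hp2 : p ≠ 2) (hρ : W.HasSurjectiveModNGaloisRep p)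
    (hI : padicValNat p (AddSubgroup.zmultiples P).index ≤ 1)
    (hr : W.analyticRank = 1) {s : ℚ} (hs : shaAn W = (s : ℂ)) (hv : padicValRat p s = 2)
    (W' : WeierstrassCurve ℚ) [W'.IsElliptic]
    (θ : geomTorsion W' (p : ℤ) ≃+ geomTorsion W (p : ℤ))
    (hθ : ∀ (σ : Field.absoluteGaloisGroup ℚ) (P : geomTorsion W' (p : ℤ)), θ (σ • P) = σ • θ P)
    (hrank : 3 ≤ W'.mordellWeilRank)
    {E₀ F₀ : WeierstrassCurve ℤ} (hE : E₀.map (Int.castRingHom ℚ) = W)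
    (hF : F₀.map (Int.castRingHom ℚ) = W') (L : List ℕ) (hpL : p ∈ L)
    (hΔE : ∀ q : ℕ, q.Prime → (q : ℤ) ∣ E₀.Δ → q ∈ L)
    (hΔF : ∀ q : ℕ, q.Prime → (q : ℤ) ∣ F₀.Δ → q ∈ L)
    (hmult' : Mult W' p) (hj' : ¬ (p : ℤ) ∣ padicValRat p W'.j)
    (hloc : ∀ v : HeightOneSpectrum (𝓞 ℚ), (Rat.HeightOneSpectrum.primesEquiv v : ℕ) ∈ L →
      (Rat.HeightOneSpectrum.primesEquiv v : ℕ) ≠ p →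
      Nat.card (nsmulAddMonoidHom p :
        (W'.baseChange (v.adicCompletion ℚ)).toAffine.Point →+ _).ker = 1) :
    BSDp W p := by
  refine bsdp_of_kolyvagin_of_congr_of_primeList W p hCT hGZK hKo hB hK hH hP hnt hp2 hρ hI hr hs hv
    W' θ hθ hrank hE hF L hpL hΔE hΔF fun v hvL ↦ ?_
  by_cases hvp : (Rat.HeightOneSpectrum.primesEquiv v : ℕ) = p
  · exact natCard_ker_nsmul_adicCompletion_eq_one_of_mult_of_not_dvd_padicValRat_j W' p hp2 hmult'
      hj' hvp
  · exact hloc v hvL hvp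

end Summit.BirchSwinnertonDyer.Rank1Residual.X11b

end
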